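import Mathlib
import Literature.AlgebraicGeometry.Tropical.TorusCycles
import Summits.HodgeConjecture.HodgeConjecture.Theses.TropicalWeilObstruction
import Summits.HodgeConjecture.HodgeConjecture.Theorems.TropicalWeilObstructionTropicalWeilVanishingFlatObstructed
import Summits.HodgeConjecture.HodgeConjecture.Theorems.TropicalWeilObstructionTropicalWeilVanishingTransportToIdentity
import HarnessLib

/-!
# Crux `TropicalWeilVanishing` (stmt-HodgeConjecture-18478) closed modulo ONE hypothesis — the bet
# `stub_nonflatObstructedAtIdentity` of line `identity_transfer`

Route `TropicalWeilObstruction` of `HodgeConjecture`. The line `identity_transfer`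
(`Cruxes/TropicalWeilVanishing/Lines/identity_transfer.lean`) composes the crux K1 from three registered
stubs; two of them are now tree theorems — `flatObstructed_of_weilFunctional_ne_zero`
(`stub_rung_flatObstructed`, file `…FlatObstructed`) and `transportToIdentity` (`stub_transportToIdentity`,
file `…TransportToIdentity`). `tropicalWeilVanishing_of_nonflatObstructed` is the skeleton's composition
`TropicalWeilVanishing_of` with those two discharged: the crux
`Theses.TropicalWeilObstruction.TropicalWeilVanishing` follows from the single remaining statement
(`stub_nonflatObstructedAtIdentity`, predicates unfolded verbatim) "every NON-flat effective tropical
`4`-cycle on `ℝ⁸/ℤ⁸` with `W ≠ 0` is obstructed at the identity". Proof = the skeleton's: transport a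
counterexample to `Q = 1`, get a functional `ℓ` killing every realisable symmetric `J`-commuting period
and non-zero at some `D ∈ Sym_J`; `1` and `1 + εD` are realisable for small `ε`, so `ε ℓ(D) = 0`.

Mathlib + the two sibling theorems; no definition, no named fact, no sorry (a CONDITIONAL reduction:
the hypothesis is the open bet, not a published fact).

## References

* [Zharkov2020TropicalWeil] I. Zharkov, Tropical abelian varieties, Weil classes and the Hodge
  conjecture, arXiv:2002.02347 (2020), §1–2 (pp. 2–4).
* [MikhalkinZharkov2014Eigenwave] G. Mikhalkin, I. Zharkov, Tropical eigenwave and intermediate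
  Jacobians, LN UMI 15 (2014), Def. 4.2, Prop. 4.3.
-/

-- `Summit.HodgeConjecture.HodgeConjecture.…` is the mandated namespace (single-conjunct summit).
set_option linter.dupNamespace false

noncomputable section

open scoped BigOperators Matrix Topology
open Matrix Literature.AlgebraicGeometry.Tropical

namespace Summit.HodgeConjecture.HodgeConjecture.Theorems.TropicalWeilVanishing

/-- **K1 from the bet.** If every non-flat effective tropical `4`-cycle `Z₀` on the standard torus
`ℝ⁸/ℤ⁸` with `W(Z₀) ≠ 0` is obstructed at the identity (some linear functional on `8 × 8` matrices,
non-zero on `Sym_J`, kills every symmetric `J`-commuting period over which the combinatorial type of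
`Z₀` realises), then the crux `TropicalWeilVanishing` holds: every effective tropical `4`-cycle over a
Weil-generic period has `W = 0`. (Flat cycles: `flatObstructed_of_weilFunctional_ne_zero`; transport to
the identity: `transportToIdentity`.) [cite: Zharkov2020TropicalWeil, §1–2 (pp. 2–4)]
[cite: MikhalkinZharkov2014Eigenwave, Def. 4.2 and Prop. 4.3] -/
theorem tropicalWeilVanishing_of_nonflatObstructed
    (h₃ : ∀ Z₀ : TropicalTorusCycle (2 * 4) 4 (1 : Matrix (Fin (2 * 4)) (Fin (2 * 4)) ℝ),
      weilFunctional Z₀ ≠ 0 →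
      ¬ (∀ σ σ' : Fin Z₀.numCells, ∀ m : Fin 4, ∃ c : Fin 4 → ℝ,
          ∀ a : Fin (2 * 4), ((Z₀.cell σ).frame a m : ℝ) =
            ∑ m' : Fin 4, ((Z₀.cell σ').frame a m' : ℝ) * c m') →
      ∃ ℓ : Matrix (Fin (2 * 4)) (Fin (2 * 4)) ℝ →ₗ[ℝ] ℝ,
        (∃ D : Matrix (Fin (2 * 4)) (Fin (2 * 4)) ℝ, D.IsSymm ∧
          D * weilJ 4 = weilJ 4 * D ∧ ℓ D ≠ 0) ∧
        ∀ Q' : Matrix (Fin (2 * 4)) (Fin (2 * 4)) ℝ, Q'.IsSymm → Q' * weilJ 4 = weilJ 4 * Q' →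
          (∃ Z' : TropicalTorusCycle (2 * 4) 4 Q',
            ∃ (hc : Z'.numCells = Z₀.numCells) (hf : Z'.numFacetClasses = Z₀.numFacetClasses),
              ∀ σ : Fin Z'.numCells,
                (Z'.cell σ).weight = (Z₀.cell (Fin.cast hc σ)).weight ∧
                (Z'.cell σ).frame = (Z₀.cell (Fin.cast hc σ)).frame ∧
                ∀ i : Fin (4 + 1),
                  Fin.cast hf (Z'.facetClass σ i) = Z₀.facetClass (Fin.cast hc σ) i ∧
                  Z'.facetPerm σ i = Z₀.facetPerm (Fin.cast hc σ) i ∧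
                  Z'.facetShift σ i = Z₀.facetShift (Fin.cast hc σ) i) → ℓ Q' = 0) :
    Theses.TropicalWeilObstruction.TropicalWeilVanishing := by
  intro Q hQ hJ hgen Z
  by_contra hW
  obtain ⟨Z₀, hW₀, O, hO, h1O, hall⟩ := transportToIdentity ⟨Q, hQ, hJ, hgen, Z, hW⟩
  -- the rung (flat case) or the bet (non-flat case) gives the obstruction at the identity
  obtain ⟨ℓ, ⟨D, hDsymm, hDJ, hℓD⟩, hvan⟩ :
      ∃ ℓ : Matrix (Fin (2 * 4)) (Fin (2 * 4)) ℝ →ₗ[ℝ] ℝ,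
        (∃ D : Matrix (Fin (2 * 4)) (Fin (2 * 4)) ℝ, D.IsSymm ∧
          D * weilJ 4 = weilJ 4 * D ∧ ℓ D ≠ 0) ∧
        ∀ Q' : Matrix (Fin (2 * 4)) (Fin (2 * 4)) ℝ, Q'.IsSymm → Q' * weilJ 4 = weilJ 4 * Q' →
          (∃ Z' : TropicalTorusCycle (2 * 4) 4 Q',
            ∃ (hc : Z'.numCells = Z₀.numCells) (hf : Z'.numFacetClasses = Z₀.numFacetClasses),
              ∀ σ : Fin Z'.numCells,
                (Z'.cell σ).weight = (Z₀.cell (Fin.cast hc σ)).weight ∧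
                (Z'.cell σ).frame = (Z₀.cell (Fin.cast hc σ)).frame ∧
                ∀ i : Fin (4 + 1),
                  Fin.cast hf (Z'.facetClass σ i) = Z₀.facetClass (Fin.cast hc σ) i ∧
                  Z'.facetPerm σ i = Z₀.facetPerm (Fin.cast hc σ) i ∧
                  Z'.facetShift σ i = Z₀.facetShift (Fin.cast hc σ) i) → ℓ Q' = 0 := by
    by_cases hflat : ∀ σ σ' : Fin Z₀.numCells, ∀ m : Fin 4, ∃ c : Fin 4 → ℝ,
        ∀ a : Fin (2 * 4), ((Z₀.cell σ).frame a m : ℝ) =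
          ∑ m' : Fin 4, ((Z₀.cell σ').frame a m' : ℝ) * c m'
    · exact flatObstructed_of_weilFunctional_ne_zero Z₀ hW₀ hflat
    · exact h₃ Z₀ hW₀ hflat
  -- the identity period is realisable (by `Z₀` itself), hence `ℓ 1 = 0`
  have h1 : ℓ 1 = 0 :=
    hvan 1 Matrix.isSymm_one (by rw [Matrix.one_mul, Matrix.mul_one])
      ⟨Z₀, rfl, rfl, fun σ => ⟨rfl, rfl, fun i => ⟨rfl, rfl, rfl⟩⟩⟩
  -- `1 + ε • D ∈ O` for all small `ε`
  have hcont : Continuous fun ε : ℝ => (1 : Matrix (Fin (2 * 4)) (Fin (2 * 4)) ℝ) + ε • D :=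
    continuous_const.add (continuous_id.smul continuous_const)
  have hev : ∀ᶠ ε in 𝓝 (0 : ℝ), (1 : Matrix (Fin (2 * 4)) (Fin (2 * 4)) ℝ) + ε • D ∈ O := by
    apply hcont.continuousAt.eventually_mem
    apply hO.mem_nhds
    simpa using h1O
  obtain ⟨δ, hδ, hball⟩ := Metric.eventually_nhds_iff.1 hev
  set ε : ℝ := δ / 2 with hε
  have hεpos : 0 < ε := by rw [hε]; linarith
  have hεO : (1 : Matrix (Fin (2 * 4)) (Fin (2 * 4)) ℝ) + ε • D ∈ O := by
    apply hball
    rw [Real.dist_eq, sub_zero, abs_of_pos hεpos, hε]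
    linarith
  -- `1 + ε • D` is a symmetric `J`-commuting period, realisable by `hall`, hence killed by `ℓ`
  have hsymm : ((1 : Matrix (Fin (2 * 4)) (Fin (2 * 4)) ℝ) + ε • D).IsSymm :=
    Matrix.isSymm_one.add (hDsymm.smul ε)
  have hcomm : ((1 : Matrix (Fin (2 * 4)) (Fin (2 * 4)) ℝ) + ε • D) * weilJ 4 =
      weilJ 4 * ((1 : Matrix (Fin (2 * 4)) (Fin (2 * 4)) ℝ) + ε • D) := by
    rw [Matrix.add_mul, Matrix.mul_add, Matrix.one_mul, Matrix.mul_one, Matrix.smul_mul,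
      Matrix.mul_smul, hDJ]
  have h2 : ℓ ((1 : Matrix (Fin (2 * 4)) (Fin (2 * 4)) ℝ) + ε • D) = 0 :=
    hvan _ hsymm hcomm (hall _ hεO hsymm hcomm)
  rw [map_add, map_smul, h1, zero_add, smul_eq_mul] at h2
  rcases mul_eq_zero.1 h2 with h | h
  · exact absurd h hεpos.ne'
  · exact hℓD h

end Summit.HodgeConjecture.HodgeConjecture.Theorems.TropicalWeilVanishing

end
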